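import Literature.Geometry.Riemannian.TwistorPackage
import Literature.Geometry.Riemannian.SelfDualMetricFrameProofs
import HarnessLib

/-!
# The twistor fibre is frame independent: change of positive orthonormal frame
(topic `Geometry/Riemannian`; support for `exists_twistorSpace`, `TwistorPackage.lean`)

Pointwise linear algebra behind the twistor space of an oriented Riemannian 4-manifold
(Atiyah–Hitchin–Singer 1978, §1 and §4; Besse 1987, 13.44; Fine–Krasnov–Panov 2014, §2.2).
For a `g_x`-orthonormal 4-frame `e` of `T_x M` (`dim = 4`) and `ζ ∈ ℝ³`, the file
`TwistorPackage.lean` defines the endomorphism `J_ζ(e) = Σᵢ ζᵢ Jᵢ(e)` (`frameComplexStructure`),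
`Jᵢ(e)` being obtained by raising an index on Hamilton's self-dual bivectors `φᵢ(e)`. We prove:

* the explicit action of `J_ζ(e)` on the frame (`frameComplexStructure_apply_frame`, matrix
  `twistorMatrix ζ`), `J_ζ(e)² = -|ζ|²` (`frameComplexStructure_comp_self`) and the quaternion
  relations `J_ζ J_η = -⟨ζ, η⟩ + J_{ζ × η}` (`frameComplexStructure_comp`);
* **the derivation lemma** (`comm_frameComplexStructure`): for a `g_x`-skew endomorphism `A`,
  `[A, J_ζ(e)] = J_{Φ_A × ζ}(e)` with `(Φ_A)ᵢ = Σ_{(a,b) ∈ φᵢ} g(A e_a, e_b)` — the induced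
  action of `so(T_x M)` on `Λ⁺ ≅ ℝ³` (FKP 2014, §2.2; it yields the connection and curvature
  vectors `c`, `Φ` of the coupling form);
* **frame independence of the fibre** (`frameComplexStructure_frameChange`): if `e, e'` are
  `g_x`-orthonormal frames of the same orientation (some alternating 4-form has the same sign on
  them), then `J_ζ(e') = J_{T ζ}(e)` for the explicit linear map
  `T = frameTransition g x e e'`, `(T ζ)ₘ = g(J_ζ(e') e₀, e_{m+1})`, which preserves the
  Euclidean norm, the dot and the cross product (`frameTransition ∈ SO(3)`); `T` is the identity
  for `e' = e` and satisfies the cocycle identity. The mechanism: a `g`-skew `X` is `J_a(e)` with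
  `aₘ = g(X e₀, e_{m+1})` as soon as its matrix `x_{ab} = g(X e_a, e_b)` satisfies
  `Pf(x) = ½ Σ_{a<b} x_{ab}²` (`= Σ` of three squares `(x₀₁-x₂₃)², (x₀₂+x₁₃)², (x₀₃-x₁₂)²`
  vanishing), and both sides are invariants of `SO(4)`: `Pf(Aᵀ x A) = det A · Pf(x)`
  (`Matrix.pfaffianFour_conj`) and `Σ (AᵀxA)_{ab}² = Σ x_{ab}²` for orthogonal `A`.

Everything here is proved; no named facts are introduced.

## References

* M. F. Atiyah, N. J. Hitchin, I. M. Singer, *Self-duality in four-dimensional Riemannian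
  geometry*, Proc. R. Soc. A 362 (1978), §1, §4. [AtiyahHitchinSinger1978]
* A. L. Besse, *Einstein Manifolds* (1987), 1.126–1.128, 13.44. [Besse1987]
* J. Fine, K. Krasnov, D. Panov, *A gauge theoretic approach to Einstein 4-manifolds*,
  New York J. Math. 20 (2014), §2.2. [FineKrasnovPanov2014]
-/

noncomputable section

open scoped Manifold ContDiff Matrix BigOperators
open Module

namespace Literature.Geometry.Riemannian

open Literature.Geometry.Lorentzian (PseudoRiemannianMetric)
open Literature.Geometry.Lorentzian.PseudoRiemannianMetric

/-! ### The matrix of `J_ζ(e)` in the frame `e` -/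

/-- The matrix of `J_ζ(e)` on an orthonormal frame: `J_ζ(e) e_c = Σ_d (twistorMatrix ζ)_{cd} e_d`
(`frameComplexStructure_apply_frame`); rows `(0, ζ₀, ζ₁, ζ₂)`, `(-ζ₀, 0, ζ₂, -ζ₁)`,
`(-ζ₁, -ζ₂, 0, ζ₀)`, `(-ζ₂, ζ₁, -ζ₀, 0)` (left multiplication by the imaginary quaternion `ζ`).
[cite: FineKrasnovPanov2014, §2.2] -/
def twistorMatrix (ζ : Fin 3 → ℝ) : Matrix (Fin 4) (Fin 4) ℝ :=
  !![0, ζ 0, ζ 1, ζ 2; -ζ 0, 0, ζ 2, -ζ 1; -ζ 1, -ζ 2, 0, ζ 0; -ζ 2, ζ 1, -ζ 0, 0]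

/-- `twistorMatrix` is linear: additivity. [folklore] -/
theorem twistorMatrix_add (ζ η : Fin 3 → ℝ) :
    twistorMatrix (ζ + η) = twistorMatrix ζ + twistorMatrix η := by
  ext i j
  fin_cases i <;> fin_cases j <;> simp [twistorMatrix] <;> ring

/-- `twistorMatrix` is linear: homogeneity. [folklore] -/
theorem twistorMatrix_smul (r : ℝ) (ζ : Fin 3 → ℝ) :
    twistorMatrix (r • ζ) = r • twistorMatrix ζ := by
  ext i j
  fin_cases i <;> fin_cases j <;> simp [twistorMatrix]

/-- `twistorMatrix ζ` is skew. [folklore] -/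
theorem twistorMatrix_transpose (ζ : Fin 3 → ℝ) : (twistorMatrix ζ)ᵀ = -twistorMatrix ζ := by
  ext i j
  fin_cases i <;> fin_cases j <;> simp [twistorMatrix]

/-- The first row of `twistorMatrix ζ` recovers `ζ`: `(twistorMatrix ζ)_{0, m+1} = ζₘ`. [folklore] -/
theorem twistorMatrix_zero_succ (ζ : Fin 3 → ℝ) (m : Fin 3) :
    twistorMatrix ζ 0 m.succ = ζ m := by
  fin_cases m <;> rfl

/-- **Quaternion relations for the matrices**: `M(η) M(ζ) = -⟨ζ, η⟩ 1 + M(ζ × η)` (the order is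
reversed because `M` is the transpose of the usual matrix of `J`). [cite: FineKrasnovPanov2014, §2.2] -/
theorem twistorMatrix_mul (ζ η : Fin 3 → ℝ) :
    twistorMatrix η * twistorMatrix ζ =
      -(ζ ⬝ᵥ η) • (1 : Matrix (Fin 4) (Fin 4) ℝ) + twistorMatrix (crossProduct ζ η) := by
  ext i j
  simp only [Matrix.mul_apply, Fin.sum_univ_four, Matrix.add_apply, Matrix.smul_apply,
    smul_eq_mul, dotProduct, Fin.sum_univ_three]
  fin_cases i <;> fin_cases j <;> simp [twistorMatrix, crossProduct] <;> ring

/-- **The derivation identity for the matrices**: for a skew `4 × 4` matrix `α`,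
`M(ζ) α - α M(ζ) = M(Φ_α × ζ)` with `Φ_α = (α₀₁ + α₂₃, α₀₂ + α₃₁, α₀₃ + α₁₂)` (the action of
`so(4)` on `Λ⁺ ≅ ℝ³`). [cite: FineKrasnovPanov2014, §2.2] -/
theorem twistorMatrix_comm (ζ : Fin 3 → ℝ) (α : Matrix (Fin 4) (Fin 4) ℝ) (hα : αᵀ = -α) :
    twistorMatrix ζ * α - α * twistorMatrix ζ =
      twistorMatrix (crossProduct ![α 0 1 + α 2 3, α 0 2 + α 3 1, α 0 3 + α 1 2] ζ) := by
  have h : ∀ i j, α j i = -α i j := fun i j ↦ by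
    have := congrFun (congrFun hα i) j
    simpa using this
  have d0 : α 0 0 = 0 := by linarith [h 0 0]
  have d1 : α 1 1 = 0 := by linarith [h 1 1]
  have d2 : α 2 2 = 0 := by linarith [h 2 2]
  have d3 : α 3 3 = 0 := by linarith [h 3 3]
  have h01 := h 0 1; have h02 := h 0 2; have h03 := h 0 3
  have h12 := h 1 2; have h13 := h 1 3; have h23 := h 2 3
  ext i j
  simp only [Matrix.sub_apply, Matrix.mul_apply, Fin.sum_univ_four]
  fin_cases i <;> fin_cases j <;>
    simp [twistorMatrix, crossProduct, d0, d1, d2, d3, h01, h02, h03, h12, h13, h23] <;> ring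

/-- The Pfaffian of a `4 × 4` matrix (meaningful for skew matrices):
`Pf(x) = x₀₁ x₂₃ - x₀₂ x₁₃ + x₀₃ x₁₂`. [folklore] -/
def _root_.Matrix.pfaffianFour {R : Type*} [CommRing R] (x : Matrix (Fin 4) (Fin 4) R) : R :=
  x 0 1 * x 2 3 - x 0 2 * x 1 3 + x 0 3 * x 1 2

/-- Laplace expansion of a `4 × 4` determinant along the first row. [folklore] -/
theorem _root_.Matrix.det_fin_four {R : Type*} [CommRing R] (A : Matrix (Fin 4) (Fin 4) R) :
    A.det =
      A 0 0 * (A 1 1 * A 2 2 * A 3 3 - A 1 1 * A 2 3 * A 3 2 - A 1 2 * A 2 1 * A 3 3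
        + A 1 2 * A 2 3 * A 3 1 + A 1 3 * A 2 1 * A 3 2 - A 1 3 * A 2 2 * A 3 1)
      - A 0 1 * (A 1 0 * A 2 2 * A 3 3 - A 1 0 * A 2 3 * A 3 2 - A 1 2 * A 2 0 * A 3 3
        + A 1 2 * A 2 3 * A 3 0 + A 1 3 * A 2 0 * A 3 2 - A 1 3 * A 2 2 * A 3 0)
      + A 0 2 * (A 1 0 * A 2 1 * A 3 3 - A 1 0 * A 2 3 * A 3 1 - A 1 1 * A 2 0 * A 3 3
        + A 1 1 * A 2 3 * A 3 0 + A 1 3 * A 2 0 * A 3 1 - A 1 3 * A 2 1 * A 3 0)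
      - A 0 3 * (A 1 0 * A 2 1 * A 3 2 - A 1 0 * A 2 2 * A 3 1 - A 1 1 * A 2 0 * A 3 2
        + A 1 1 * A 2 2 * A 3 0 + A 1 2 * A 2 0 * A 3 1 - A 1 2 * A 2 1 * A 3 0) := by
  have s1 : Fin.succ (0 : Fin 3) = (1 : Fin 4) := by decide
  have s2 : Fin.succ (1 : Fin 3) = (2 : Fin 4) := by decide
  have s3 : Fin.succ (2 : Fin 3) = (3 : Fin 4) := by decide
  have a00 : (0 : Fin 4).succAbove (0 : Fin 3) = 1 := by decide
  have a01 : (0 : Fin 4).succAbove (1 : Fin 3) = 2 := by decide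
  have a02 : (0 : Fin 4).succAbove (2 : Fin 3) = 3 := by decide
  have a10 : (1 : Fin 4).succAbove (0 : Fin 3) = 0 := by decide
  have a11 : (1 : Fin 4).succAbove (1 : Fin 3) = 2 := by decide
  have a12 : (1 : Fin 4).succAbove (2 : Fin 3) = 3 := by decide
  have a20 : (2 : Fin 4).succAbove (0 : Fin 3) = 0 := by decide
  have a21 : (2 : Fin 4).succAbove (1 : Fin 3) = 1 := by decide
  have a22 : (2 : Fin 4).succAbove (2 : Fin 3) = 3 := by decide
  have a30 : (3 : Fin 4).succAbove (0 : Fin 3) = 0 := by decide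
  have a31 : (3 : Fin 4).succAbove (1 : Fin 3) = 1 := by decide
  have a32 : (3 : Fin 4).succAbove (2 : Fin 3) = 2 := by decide
  have v3 : ((3 : Fin 4) : ℕ) = 3 := rfl
  rw [Matrix.det_succ_row_zero, Fin.sum_univ_four]
  simp only [Matrix.det_fin_three, Matrix.submatrix_apply, s1, s2, s3, a00, a01, a02, a10, a11,
    a12, a20, a21, a22, a30, a31, a32, Fin.val_zero, Fin.val_one, Fin.val_two, v3, pow_zero,
    pow_one]
  ring

/-- **`Pf(Aᵀ x A) = det A · Pf(x)`** for a skew real `4 × 4` matrix `x` (the Pfaffian is a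
relative invariant of weight `det`). [folklore] -/
theorem _root_.Matrix.pfaffianFour_conj (A x : Matrix (Fin 4) (Fin 4) ℝ) (hx : xᵀ = -x) :
    (Aᵀ * x * A).pfaffianFour = A.det * x.pfaffianFour := by
  have h : ∀ i j, x j i = -x i j := fun i j ↦ by
    have := congrFun (congrFun hx i) j
    simpa using this
  have d0 : x 0 0 = 0 := by linarith [h 0 0]
  have d1 : x 1 1 = 0 := by linarith [h 1 1]
  have d2 : x 2 2 = 0 := by linarith [h 2 2]
  have d3 : x 3 3 = 0 := by linarith [h 3 3]
  have h01 := h 0 1; have h02 := h 0 2; have h03 := h 0 3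
  have h12 := h 1 2; have h13 := h 1 3; have h23 := h 2 3
  simp only [Matrix.pfaffianFour, Matrix.mul_apply, Matrix.transpose_apply, Fin.sum_univ_four,
    Matrix.det_fin_four, d0, d1, d2, d3, h01, h02, h03, h12, h13, h23]
  ring

/-- The sum of the squares of the entries of a real matrix is the trace of `xᵀ x`. [folklore] -/
theorem _root_.Matrix.sum_sq_eq_trace {m : Type*} [Fintype m] (x : Matrix m m ℝ) :
    ∑ i, ∑ j, x i j ^ 2 = (xᵀ * x).trace := by
  simp only [Matrix.trace, Matrix.diag_apply, Matrix.mul_apply, Matrix.transpose_apply, sq]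
  rw [Finset.sum_comm]

/-- **`Σ (Aᵀ x A)_{ab}² = Σ x_{ab}²` for orthogonal `A`** (`A Aᵀ = 1`). [folklore] -/
theorem _root_.Matrix.sum_sq_conj_of_orthogonal {m : Type*} [Fintype m] [DecidableEq m]
    (A x : Matrix m m ℝ) (hA : A * Aᵀ = 1) :
    ∑ i, ∑ j, (Aᵀ * x * A) i j ^ 2 = ∑ i, ∑ j, x i j ^ 2 := by
  rw [Matrix.sum_sq_eq_trace, Matrix.sum_sq_eq_trace]
  have : (Aᵀ * x * A)ᵀ * (Aᵀ * x * A) = Aᵀ * (xᵀ * x * A) := by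
    simp only [Matrix.transpose_mul, Matrix.transpose_transpose, Matrix.mul_assoc]
    rw [← Matrix.mul_assoc A Aᵀ, hA, Matrix.one_mul]
  rw [this, Matrix.trace_mul_comm, Matrix.mul_assoc, hA, Matrix.mul_one]

/-- Sum of the squares of the entries of `twistorMatrix ζ`: `4 |ζ|²`. [folklore] -/
theorem sum_sq_twistorMatrix (ζ : Fin 3 → ℝ) :
    ∑ c, ∑ d, twistorMatrix ζ c d ^ 2 = 4 * (ζ ⬝ᵥ ζ) := by
  simp only [Fin.sum_univ_four, dotProduct, Fin.sum_univ_three]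
  simp [twistorMatrix]
  ring

/-- The Pfaffian of `twistorMatrix ζ` is `|ζ|²`. [folklore] -/
theorem pfaffianFour_twistorMatrix (ζ : Fin 3 → ℝ) :
    (twistorMatrix ζ).pfaffianFour = ζ ⬝ᵥ ζ := by
  simp only [Matrix.pfaffianFour, dotProduct, Fin.sum_univ_three]
  simp [twistorMatrix]

/-- **Self-duality from the Pfaffian.** A skew real `4 × 4` matrix `x` with
`Σ_{c,d} x_{cd}² = 4 Pf(x)` (i.e. `(x₀₁-x₂₃)² + (x₀₂+x₁₃)² + (x₀₃-x₁₂)² = 0`) is the twistor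
matrix of its first row: `x = twistorMatrix (x₀₁, x₀₂, x₀₃)`. [folklore] -/
theorem _root_.Matrix.eq_twistorMatrix_of_pfaffianFour (x : Matrix (Fin 4) (Fin 4) ℝ)
    (hx : xᵀ = -x) (h : ∑ c, ∑ d, x c d ^ 2 = 4 * x.pfaffianFour) :
    x = twistorMatrix ![x 0 1, x 0 2, x 0 3] := by
  have hs : ∀ i j, x j i = -x i j := fun i j ↦ by
    have := congrFun (congrFun hx i) j
    simpa using this
  have d0 : x 0 0 = 0 := by linarith [hs 0 0]
  have d1 : x 1 1 = 0 := by linarith [hs 1 1]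
  have d2 : x 2 2 = 0 := by linarith [hs 2 2]
  have d3 : x 3 3 = 0 := by linarith [hs 3 3]
  have h01 := hs 0 1; have h02 := hs 0 2; have h03 := hs 0 3
  have h12 := hs 1 2; have h13 := hs 1 3; have h23 := hs 2 3
  simp only [Fin.sum_univ_four, Matrix.pfaffianFour, d0, d1, d2, d3, h01, h02, h03, h12, h13,
    h23] at h
  have hsq : (x 0 1 - x 2 3) ^ 2 + (x 0 2 + x 1 3) ^ 2 + (x 0 3 - x 1 2) ^ 2 = 0 := by
    linear_combination h / 2
  have n1 := sq_nonneg (x 0 1 - x 2 3)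
  have n2 := sq_nonneg (x 0 2 + x 1 3)
  have n3 := sq_nonneg (x 0 3 - x 1 2)
  have a1 : (x 0 1 - x 2 3) ^ 2 = 0 := by linarith
  have a2 : (x 0 2 + x 1 3) ^ 2 = 0 := by linarith
  have a3 : (x 0 3 - x 1 2) ^ 2 = 0 := by linarith
  have e1 : x 2 3 = x 0 1 := by have := pow_eq_zero_iff (n := 2) two_ne_zero |>.1 a1; linarith
  have e2 : x 1 3 = -x 0 2 := by have := pow_eq_zero_iff (n := 2) two_ne_zero |>.1 a2; linarith
  have e3 : x 1 2 = x 0 3 := by have := pow_eq_zero_iff (n := 2) two_ne_zero |>.1 a3; linarith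
  ext i j
  fin_cases i <;> fin_cases j <;>
    simp [twistorMatrix, d0, d1, d2, d3, h01, h02, h03, h12, h13, h23, e1, e2, e3]

/-! ### Endomorphisms of `T_x M` in an orthonormal 4-frame -/

section Frame

variable {E : Type*} [NormedAddCommGroup E] [NormedSpace ℝ E] {H : Type*} [TopologicalSpace H]
  {I : ModelWithCorners ℝ E H} {M : Type*} [TopologicalSpace M] [ChartedSpace H M]
  [IsManifold I ∞ M] {n : ℕ∞ω} [FiniteDimensional ℝ E]
  {g : PseudoRiemannianMetric I n E (TangentSpace I : M → Type _)} {x : M}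
  {e : Fin 4 → TangentSpace I x}

omit [FiniteDimensional ℝ E] in
/-- In an orthonormal frame `g(e_a, e_b) = δ_{ab}` (copy of `IsOrthonormalFrame.val_eq_ite` of
`ChangGurskyYangProofs.lean`, not imported here). [folklore] -/
theorem _root_.Literature.Geometry.Lorentzian.PseudoRiemannianMetric.IsOrthonormalFrame.val_ite
    {ι : Type*} [DecidableEq ι] {f : ι → TangentSpace I x} (hf : g.IsOrthonormalFrame x f)
    (a b : ι) : g.val x (f a) (f b) = if a = b then 1 else 0 := by
  split_ifs with h
  · subst h; exact hf.1 a
  · exact hf.2 a b h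

variable (g e) in
/-- The matrix of an endomorphism `T` of `T_x M` read in a frame `e` through the metric:
`(frameMatrix g e T)_{cd} = g_x(T e_c, e_d)`; for a `g_x`-orthonormal frame of a 4-dimensional
tangent space, `T e_c = Σ_d (frameMatrix g e T)_{cd} e_d` (`apply_frame_eq_sum`). [folklore] -/
def frameMatrix (T : TangentSpace I x →L[ℝ] TangentSpace I x) : Matrix (Fin 4) (Fin 4) ℝ :=
  Matrix.of fun c d ↦ g.val x (T (e c)) (e d)

omit [FiniteDimensional ℝ E] in
/-- Unfolding `frameMatrix`. [folklore] -/
@[simp] theorem frameMatrix_apply (T : TangentSpace I x →L[ℝ] TangentSpace I x) (c d : Fin 4) :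
    frameMatrix g e T c d = g.val x (T (e c)) (e d) := rfl

omit [FiniteDimensional ℝ E] in
/-- `frameMatrix` is additive. [folklore] -/
theorem frameMatrix_add (T T' : TangentSpace I x →L[ℝ] TangentSpace I x) :
    frameMatrix g e (T + T') = frameMatrix g e T + frameMatrix g e T' := by
  ext c d
  simp [map_add]

omit [FiniteDimensional ℝ E] in
/-- `frameMatrix` is compatible with subtraction. [folklore] -/
theorem frameMatrix_sub (T T' : TangentSpace I x →L[ℝ] TangentSpace I x) :
    frameMatrix g e (T - T') = frameMatrix g e T - frameMatrix g e T' := by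
  ext c d
  simp [map_sub]

omit [FiniteDimensional ℝ E] in
/-- `frameMatrix` is homogeneous. [folklore] -/
theorem frameMatrix_smul (r : ℝ) (T : TangentSpace I x →L[ℝ] TangentSpace I x) :
    frameMatrix g e (r • T) = r • frameMatrix g e T := by
  ext c d
  simp [map_smul]

omit [FiniteDimensional ℝ E] in
/-- The matrix of the identity in an orthonormal frame is `1`. [folklore] -/
theorem frameMatrix_id (he : g.IsOrthonormalFrame x e) :
    frameMatrix g e (ContinuousLinearMap.id ℝ (TangentSpace I x)) = 1 := by
  ext c d
  simp [he.val_ite, Matrix.one_apply]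

/-- **Expansion of `T e_c` in the frame.** [folklore] -/
theorem apply_frame_eq_sum (he : g.IsOrthonormalFrame x e) (hE : finrank ℝ E = 4)
    (T : TangentSpace I x →L[ℝ] TangentSpace I x) (c : Fin 4) :
    T (e c) = ∑ d, frameMatrix g e T c d • e d :=
  he.eq_sum_smul hE (T (e c))

/-- **`T` on a frame combination**: `T (Σ_c v_c e_c) = Σ_d (v ᵥ* frameMatrix T)_d e_d`. [folklore] -/
theorem apply_sum_frame (he : g.IsOrthonormalFrame x e) (hE : finrank ℝ E = 4)
    (T : TangentSpace I x →L[ℝ] TangentSpace I x) (v : Fin 4 → ℝ) :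
    T (∑ c, v c • e c) = ∑ d, (v ᵥ* frameMatrix g e T) d • e d := by
  simp only [map_sum, map_smul, Matrix.vecMul, dotProduct, Finset.sum_smul]
  rw [Finset.sum_comm]
  refine Finset.sum_congr rfl fun c _ ↦ ?_
  rw [apply_frame_eq_sum he hE T c, Finset.smul_sum]
  simp only [smul_smul]

/-- **The matrix of a composition** is the (reversed) product of the matrices. [folklore] -/
theorem frameMatrix_comp (he : g.IsOrthonormalFrame x e) (hE : finrank ℝ E = 4)
    (T T' : TangentSpace I x →L[ℝ] TangentSpace I x) :
    frameMatrix g e (T.comp T') = frameMatrix g e T' * frameMatrix g e T := by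
  ext c d
  simp only [frameMatrix_apply, ContinuousLinearMap.coe_comp, Function.comp_apply,
    Matrix.mul_apply]
  conv_lhs => rw [apply_frame_eq_sum he hE T' c]
  simp only [map_sum, map_smul, FunLike.coe_sum, FunLike.coe_smul, Finset.sum_apply,
    Pi.smul_apply, smul_eq_mul, frameMatrix_apply]

/-- **An endomorphism is determined by its matrix** in an orthonormal frame of a 4-dimensional
tangent space. [folklore] -/
theorem eq_of_frameMatrix_eq (he : g.IsOrthonormalFrame x e) (hE : finrank ℝ E = 4)
    {T T' : TangentSpace I x →L[ℝ] TangentSpace I x}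
    (h : frameMatrix g e T = frameMatrix g e T') : T = T' := by
  ext v
  rw [he.eq_sum_smul hE v, apply_sum_frame he hE T, apply_sum_frame he hE T', h]

omit [FiniteDimensional ℝ E] in
/-- **The action of `J_ζ(e)` on the frame**: `J_ζ(e) e_c = Σ_d (twistorMatrix ζ)_{cd} e_d`
(`J₁ : e₀ ↦ e₁, e₂ ↦ e₃`, `J₂ : e₀ ↦ e₂, e₃ ↦ e₁`, `J₃ : e₀ ↦ e₃, e₁ ↦ e₂`).
[cite: FineKrasnovPanov2014, §2.2] -/
theorem frameComplexStructure_apply_frame (he : g.IsOrthonormalFrame x e) (ζ : Fin 3 → ℝ)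
    (c : Fin 4) : frameComplexStructure g x e ζ (e c) = ∑ d, twistorMatrix ζ c d • e d := by
  simp only [frameComplexStructure, selfDualPairs_eq, Fin.sum_univ_three, Fin.sum_univ_two,
    Fin.sum_univ_four]
  fin_cases c <;> simp [selfDualIdx, twistorMatrix, he.val_ite] <;> module

omit [FiniteDimensional ℝ E] in
/-- **The matrix of `J_ζ(e)` in the frame `e` is `twistorMatrix ζ`.** [cite: FineKrasnovPanov2014, §2.2] -/
theorem frameMatrix_frameComplexStructure (he : g.IsOrthonormalFrame x e) (ζ : Fin 3 → ℝ) :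
    frameMatrix g e (frameComplexStructure g x e ζ) = twistorMatrix ζ := by
  ext c d
  rw [frameMatrix_apply, frameComplexStructure_apply_frame he]
  simp [map_sum, map_smul, he.val_ite]

omit [FiniteDimensional ℝ E] in
/-- `J_0(e) = 0`. [folklore] -/
@[simp] theorem frameComplexStructure_zero (e : Fin 4 → TangentSpace I x) :
    frameComplexStructure g x e 0 = 0 := by
  simp [frameComplexStructure]

/-- **Quaternion relations**: `J_ζ(e) ∘ J_η(e) = -⟨ζ, η⟩ id + J_{ζ × η}(e)` for a
`g_x`-orthonormal frame of a 4-dimensional tangent space (so `J₁J₂ = J₃` cyclically and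
`J_ζ² = -|ζ|²`). [cite: FineKrasnovPanov2014, §2.2] -/
theorem frameComplexStructure_comp (he : g.IsOrthonormalFrame x e) (hE : finrank ℝ E = 4)
    (ζ η : Fin 3 → ℝ) :
    (frameComplexStructure g x e ζ).comp (frameComplexStructure g x e η) =
      -(ζ ⬝ᵥ η) • ContinuousLinearMap.id ℝ (TangentSpace I x) +
        frameComplexStructure g x e (crossProduct ζ η) := by
  apply eq_of_frameMatrix_eq he hE
  rw [frameMatrix_comp he hE, frameMatrix_frameComplexStructure he,
    frameMatrix_frameComplexStructure he, frameMatrix_add, frameMatrix_smul, frameMatrix_id he,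
    frameMatrix_frameComplexStructure he, twistorMatrix_mul]

/-- `J_ζ(e)² = -|ζ|² id`. [cite: Besse1987, 13.44] -/
theorem frameComplexStructure_comp_self (he : g.IsOrthonormalFrame x e) (hE : finrank ℝ E = 4)
    (ζ : Fin 3 → ℝ) :
    (frameComplexStructure g x e ζ).comp (frameComplexStructure g x e ζ) =
      -(ζ ⬝ᵥ ζ) • ContinuousLinearMap.id ℝ (TangentSpace I x) := by
  rw [frameComplexStructure_comp he hE, show crossProduct ζ ζ = 0 from cross_self ζ,
    frameComplexStructure_zero, add_zero]

omit [FiniteDimensional ℝ E] in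
/-- `J_ζ(e)` is `g_x`-skew: `g(J_ζ v, w) + g(J_ζ w, v) = 0` (no orthonormality needed).
[cite: FineKrasnovPanov2014, §2.2] -/
theorem val_frameComplexStructure_add_swap (e : Fin 4 → TangentSpace I x) (ζ : Fin 3 → ℝ)
    (v w : TangentSpace I x) :
    g.val x (frameComplexStructure g x e ζ v) w + g.val x (frameComplexStructure g x e ζ w) v =
      0 := by
  simp only [frameComplexStructure, FunLike.coe_sum, FunLike.coe_smul,
    Finset.sum_apply, Pi.smul_apply, bivectorEnd_apply, map_sum, map_smul, map_sub,
    FunLike.coe_sub, Pi.sub_apply, smul_eq_mul]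
  rw [← Finset.sum_add_distrib]
  refine Finset.sum_eq_zero fun i _ ↦ ?_
  rw [← mul_add, ← Finset.sum_add_distrib]
  convert mul_zero (ζ i)
  refine Finset.sum_eq_zero fun k _ ↦ ?_
  rw [g.symm x (selfDualPairs e i k).2 w, g.symm x (selfDualPairs e i k).1 w,
    g.symm x (selfDualPairs e i k).2 v, g.symm x (selfDualPairs e i k).1 v]
  ring

omit [FiniteDimensional ℝ E] in
/-- The matrix of a `g_x`-skew endomorphism in an orthonormal frame is skew. [folklore] -/
theorem frameMatrix_transpose_of_skew {A : TangentSpace I x →L[ℝ] TangentSpace I x}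
    (hA : ∀ v w, g.val x (A v) w + g.val x (A w) v = 0) :
    (frameMatrix g e A)ᵀ = -frameMatrix g e A := by
  ext c d
  simp only [Matrix.transpose_apply, frameMatrix_apply, Matrix.neg_apply]
  linarith [hA (e c) (e d)]

variable (g e) in
/-- The `Λ⁺`-vector of a (`g_x`-skew) endomorphism `A` in the frame `e`:
`(Φ_A)ᵢ = Σ_{(a,b) ∈ φᵢ} g(A e_a, e_b)` (for `A = R(u,v)` this is the curvature vector
`selfDualCurvatureVec`, for `A = ∇_u` read on a frame field it is the connection vector
`selfDualConnectionVec`). [cite: FineKrasnovPanov2014, §2.2] -/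
def selfDualVecOf (A : TangentSpace I x →L[ℝ] TangentSpace I x) : Fin 3 → ℝ :=
  fun i ↦ ∑ k, g.val x (A (selfDualPairs e i k).1) (selfDualPairs e i k).2

omit [FiniteDimensional ℝ E] in
/-- `selfDualVecOf` in terms of the frame matrix of `A`. [folklore] -/
theorem selfDualVecOf_eq (A : TangentSpace I x →L[ℝ] TangentSpace I x) :
    selfDualVecOf g e A =
      ![frameMatrix g e A 0 1 + frameMatrix g e A 2 3,
        frameMatrix g e A 0 2 + frameMatrix g e A 3 1,
        frameMatrix g e A 0 3 + frameMatrix g e A 1 2] := by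
  ext i
  fin_cases i <;> simp [selfDualVecOf, selfDualPairs_eq, selfDualIdx, Fin.sum_univ_two]

/-- **The derivation lemma** (the action of `so(T_x M)` on `Λ⁺ ≅ ℝ³`): for a `g_x`-skew
endomorphism `A` and a `g_x`-orthonormal frame `e` of a 4-dimensional tangent space,
`A ∘ J_ζ(e) - J_ζ(e) ∘ A = J_{Φ_A × ζ}(e)` with `Φ_A = selfDualVecOf g e A`.
[cite: FineKrasnovPanov2014, §2.2] -/
theorem comm_frameComplexStructure (he : g.IsOrthonormalFrame x e) (hE : finrank ℝ E = 4)
    {A : TangentSpace I x →L[ℝ] TangentSpace I x}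
    (hA : ∀ v w, g.val x (A v) w + g.val x (A w) v = 0) (ζ : Fin 3 → ℝ) :
    A.comp (frameComplexStructure g x e ζ) - (frameComplexStructure g x e ζ).comp A =
      frameComplexStructure g x e (crossProduct (selfDualVecOf g e A) ζ) := by
  apply eq_of_frameMatrix_eq he hE
  rw [frameMatrix_sub, frameMatrix_comp he hE, frameMatrix_comp he hE,
    frameMatrix_frameComplexStructure he, frameMatrix_frameComplexStructure he,
    twistorMatrix_comm ζ _ (frameMatrix_transpose_of_skew hA), selfDualVecOf_eq]

omit [FiniteDimensional ℝ E] in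
/-- `J_ζ(e)` is additive in `ζ`. [folklore] -/
theorem frameComplexStructure_add (e : Fin 4 → TangentSpace I x) (ζ η : Fin 3 → ℝ) :
    frameComplexStructure g x e (ζ + η) =
      frameComplexStructure g x e ζ + frameComplexStructure g x e η := by
  simp only [frameComplexStructure, Pi.add_apply, add_smul, Finset.sum_add_distrib]

omit [FiniteDimensional ℝ E] in
/-- `J_ζ(e)` is homogeneous in `ζ`. [folklore] -/
theorem frameComplexStructure_smul (e : Fin 4 → TangentSpace I x) (r : ℝ) (ζ : Fin 3 → ℝ) :
    frameComplexStructure g x e (r • ζ) = r • frameComplexStructure g x e ζ := by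
  simp only [frameComplexStructure, Pi.smul_apply, smul_eq_mul, mul_smul, Finset.smul_sum]

/-! ### Two orthonormal frames -/

variable {e' : Fin 4 → TangentSpace I x}

variable (g e e') in
/-- The coefficient matrix of the frame `e'` in the frame `e`: `B_{ac} = g(e'_a, e_c)`, so that
`e'_a = Σ_c B_{ac} e_c` for `e` orthonormal (`frame_eq_sum_frameCoeff`). [folklore] -/
def frameCoeff : Matrix (Fin 4) (Fin 4) ℝ :=
  Matrix.of fun a c ↦ g.val x (e' a) (e c)

omit [FiniteDimensional ℝ E] in
/-- Unfolding `frameCoeff`. [folklore] -/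
@[simp] theorem frameCoeff_apply (a c : Fin 4) : frameCoeff g e e' a c = g.val x (e' a) (e c) :=
  rfl

/-- Expansion of the second frame in the first. [folklore] -/
theorem frame_eq_sum_frameCoeff (he : g.IsOrthonormalFrame x e) (hE : finrank ℝ E = 4)
    (a : Fin 4) : e' a = ∑ c, frameCoeff g e e' a c • e c :=
  he.eq_sum_smul hE (e' a)

/-- **Parseval** in an orthonormal 4-frame: `g(v, w) = Σ_c g(v, e_c) g(w, e_c)`. [folklore] -/
theorem val_eq_sum_mul (he : g.IsOrthonormalFrame x e) (hE : finrank ℝ E = 4)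
    (v w : TangentSpace I x) : g.val x v w = ∑ c, g.val x v (e c) * g.val x w (e c) := by
  conv_lhs => rw [he.eq_sum_smul hE w]
  simp only [map_sum, map_smul, smul_eq_mul]
  exact Finset.sum_congr rfl fun c _ ↦ mul_comm _ _

/-- **The coefficient matrix of two orthonormal frames is orthogonal**: `B Bᵀ = 1`. [folklore] -/
theorem frameCoeff_mul_transpose (he : g.IsOrthonormalFrame x e) (he' : g.IsOrthonormalFrame x e')
    (hE : finrank ℝ E = 4) : frameCoeff g e e' * (frameCoeff g e e')ᵀ = 1 := by
  ext a a'
  rw [Matrix.mul_apply, Matrix.one_apply, ← he'.val_ite a a', val_eq_sum_mul he hE]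
  rfl

/-- **The matrix of `J_ζ(e')` in the frame `e`** is the orthogonal conjugate
`Bᵀ · twistorMatrix ζ · B` of its matrix in the frame `e'`. [cite: Besse1987, 1.126] -/
theorem frameMatrix_frameComplexStructure_frame'
    (he' : g.IsOrthonormalFrame x e') (hE : finrank ℝ E = 4) (ζ : Fin 3 → ℝ) :
    frameMatrix g e (frameComplexStructure g x e' ζ) =
      (frameCoeff g e e')ᵀ * twistorMatrix ζ * frameCoeff g e e' := by
  ext c d
  have hc : e c = ∑ a, frameCoeff g e e' a c • e' a := by
    conv_lhs => rw [he'.eq_sum_smul hE (e c)]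
    refine Finset.sum_congr rfl fun a _ ↦ ?_
    rw [frameCoeff_apply, g.symm x]
  rw [frameMatrix_apply, hc, apply_sum_frame he' hE, frameMatrix_frameComplexStructure he']
  simp only [map_sum, map_smul, FunLike.coe_sum, FunLike.coe_smul, Finset.sum_apply,
    Pi.smul_apply, smul_eq_mul, Matrix.mul_apply, Matrix.transpose_apply, frameCoeff_apply,
    Matrix.vecMul, dotProduct]

omit [FiniteDimensional ℝ E] in
/-- An orthonormal 4-frame is linearly independent. [folklore] -/
theorem frame_linearIndependent (he : g.IsOrthonormalFrame x e) : LinearIndependent ℝ e := by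
  rw [Fintype.linearIndependent_iff]
  intro a ha j
  have hco : g.val x (e j) (∑ i, a i • e i) = a j := by
    simp only [map_sum, map_smul, smul_eq_mul, he.val_ite]
    simp [Finset.sum_ite_eq]
  rw [ha, map_zero] at hco
  exact hco.symm

/-- The basis of `T_x M` given by an orthonormal 4-frame (`dim = 4`). [folklore] -/
def frameBasisOf (he : g.IsOrthonormalFrame x e) (hE : finrank ℝ E = 4) :
    Basis (Fin 4) ℝ (TangentSpace I x) :=
  haveI : FiniteDimensional ℝ (TangentSpace I x) := ‹FiniteDimensional ℝ E›
  Basis.mk (frame_linearIndependent he)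
    ((frame_linearIndependent he).span_eq_top_of_card_eq_finrank'
      ((Fintype.card_fin 4).trans (hE.symm.trans rfl))).ge

/-- The basis of an orthonormal frame is the frame. [folklore] -/
@[simp] theorem coe_frameBasisOf (he : g.IsOrthonormalFrame x e) (hE : finrank ℝ E = 4) :
    ⇑(frameBasisOf he hE) = e :=
  Basis.coe_mk _ _

/-- **An alternating 4-form on the second frame**: `vol e' = vol e · det B`. [folklore] -/
theorem alternating_frame'_eq (he : g.IsOrthonormalFrame x e) (hE : finrank ℝ E = 4)
    (vol : TangentSpace I x [⋀^Fin 4]→ₗ[ℝ] ℝ) :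
    vol e' = vol e * (frameCoeff g e e').det := by
  set b := frameBasisOf he hE with hb
  have h1 : vol e' = vol b * b.det e' := by
    conv_lhs => rw [AlternatingMap.eq_smul_basis_det b vol]
    rfl
  have h2 : b.toMatrix e' = (frameCoeff g e e')ᵀ := by
    ext i j
    rw [Basis.toMatrix_apply, Matrix.transpose_apply]
    have hj : e' j = ∑ c, frameCoeff g e e' j c • b c := by
      rw [hb, coe_frameBasisOf]
      exact frame_eq_sum_frameCoeff he hE j
    rw [hj, Basis.repr_sum_self]
  rw [h1, Basis.det_apply, h2, Matrix.det_transpose, hb, coe_frameBasisOf]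

/-- **Like-oriented orthonormal frames differ by a matrix of determinant one.** If some
alternating 4-form takes values of the same sign on the `g_x`-orthonormal frames `e, e'`, then
`det B = 1` for the coefficient matrix `B` of `e'` in `e`. [cite: Besse1987, 1.126] -/
theorem det_frameCoeff_eq_one (he : g.IsOrthonormalFrame x e) (he' : g.IsOrthonormalFrame x e')
    (hE : finrank ℝ E = 4) (vol : TangentSpace I x [⋀^Fin 4]→ₗ[ℝ] ℝ) (hvol : 0 < vol e * vol e') :
    (frameCoeff g e e').det = 1 := by
  set B := frameCoeff g e e' with hB
  have hsq : B.det * B.det = 1 := by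
    have h := congrArg Matrix.det (frameCoeff_mul_transpose he he' hE)
    rwa [Matrix.det_mul, Matrix.det_transpose, Matrix.det_one] at h
  have hpos : 0 < B.det := by
    rw [alternating_frame'_eq (e' := e') he hE vol, ← hB] at hvol
    have hne : vol e ≠ 0 := fun h0 ↦ by simp [h0] at hvol
    have h2 : 0 < vol e * vol e := mul_self_pos.2 hne
    nlinarith [hvol, h2]
  rcases mul_self_eq_one_iff.1 hsq with h | h
  · exact h
  · linarith

variable (g x e e') in
/-- **The transition map of the twistor fibre between two frames**: the linear map
`ℝ³ → ℝ³`, `(T ζ)ₘ = g(J_ζ(e') e₀, e_{m+1})` — the `Λ⁺(e)`-coordinates of `J_ζ(e')` read off its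
first row. For like-oriented orthonormal frames, `J_ζ(e') = J_{T ζ}(e)`
(`frameComplexStructure_frameChange`) and `T ∈ SO(3)`. [cite: AtiyahHitchinSinger1978, §1] -/
def frameTransition : (Fin 3 → ℝ) →ₗ[ℝ] (Fin 3 → ℝ) where
  toFun ζ m := g.val x (frameComplexStructure g x e' ζ (e 0)) (e m.succ)
  map_add' ζ η := by
    ext m
    simp only [frameComplexStructure_add, add_apply, map_add, Pi.add_apply]
  map_smul' r ζ := by
    ext m
    simp only [frameComplexStructure_smul, smul_apply, map_smul, Pi.smul_apply,
      RingHom.id_apply]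

omit [FiniteDimensional ℝ E] in
/-- Unfolding `frameTransition`. [folklore] -/
theorem frameTransition_apply (ζ : Fin 3 → ℝ) (m : Fin 3) :
    frameTransition g x e e' ζ m = g.val x (frameComplexStructure g x e' ζ (e 0)) (e m.succ) :=
  rfl

omit [FiniteDimensional ℝ E] in
/-- `frameTransition ζ` is the first row of the matrix of `J_ζ(e')` in the frame `e`. [folklore] -/
theorem frameTransition_eq_row (ζ : Fin 3 → ℝ) :
    frameTransition g x e e' ζ =
      ![frameMatrix g e (frameComplexStructure g x e' ζ) 0 1,
        frameMatrix g e (frameComplexStructure g x e' ζ) 0 2,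
        frameMatrix g e (frameComplexStructure g x e' ζ) 0 3] := by
  ext m
  fin_cases m <;> rfl

/-- **Frame independence of the twistor fibre.** For like-oriented `g_x`-orthonormal frames
`e, e'` of a 4-dimensional tangent space (some alternating 4-form has the same sign on them),
`J_ζ(e') = J_{T ζ}(e)` with `T = frameTransition g x e e'`: the 2-sphere
`{J_ζ(e) : |ζ| = 1}` of `g`-orthogonal complex structures inducing the orientation of `e` does
not depend on the positive orthonormal frame (Atiyah–Hitchin–Singer 1978, §1: `Λ⁺` is an
`SO(4)`-module; Besse 1987, 1.126 and 13.44). Mechanism: the matrix `x = Bᵀ M(ζ) B` of `J_ζ(e')`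
in the frame `e` is skew with `Pf(x) = det B · Pf(M(ζ)) = |ζ|²` and `Σ x² = Σ M(ζ)² = 4|ζ|²`,
hence self-dual (`Matrix.eq_twistorMatrix_of_pfaffianFour`).
[cite: AtiyahHitchinSinger1978, §1] -/
theorem frameComplexStructure_frameChange (he : g.IsOrthonormalFrame x e)
    (he' : g.IsOrthonormalFrame x e') (hE : finrank ℝ E = 4)
    (vol : TangentSpace I x [⋀^Fin 4]→ₗ[ℝ] ℝ) (hvol : 0 < vol e * vol e') (ζ : Fin 3 → ℝ) :
    frameComplexStructure g x e' ζ = frameComplexStructure g x e (frameTransition g x e e' ζ) := by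
  apply eq_of_frameMatrix_eq he hE
  set X := frameMatrix g e (frameComplexStructure g x e' ζ) with hX
  have hXeq : X = (frameCoeff g e e')ᵀ * twistorMatrix ζ * frameCoeff g e e' :=
    frameMatrix_frameComplexStructure_frame' he' hE ζ
  have hskew : Xᵀ = -X := by
    rw [hXeq, Matrix.transpose_mul, Matrix.transpose_mul, Matrix.transpose_transpose,
      twistorMatrix_transpose]
    simp only [Matrix.mul_neg, Matrix.neg_mul, Matrix.mul_assoc]
  have hsum : ∑ c, ∑ d, X c d ^ 2 = 4 * (ζ ⬝ᵥ ζ) := by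
    rw [hXeq, Matrix.sum_sq_conj_of_orthogonal _ _ (frameCoeff_mul_transpose he he' hE),
      sum_sq_twistorMatrix]
  have hpf : X.pfaffianFour = ζ ⬝ᵥ ζ := by
    rw [hXeq, Matrix.pfaffianFour_conj _ _ (twistorMatrix_transpose ζ),
      det_frameCoeff_eq_one he he' hE vol hvol, one_mul, pfaffianFour_twistorMatrix]
  have key := Matrix.eq_twistorMatrix_of_pfaffianFour X hskew (by rw [hsum, hpf])
  rw [frameMatrix_frameComplexStructure he, frameTransition_eq_row, ← hX]
  exact key

/-- **`frameTransition` preserves the Euclidean norm**: `|T ζ|² = |ζ|²`. [cite: AtiyahHitchinSinger1978, §1] -/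
theorem frameTransition_dotProduct_self (he : g.IsOrthonormalFrame x e)
    (he' : g.IsOrthonormalFrame x e') (hE : finrank ℝ E = 4)
    (vol : TangentSpace I x [⋀^Fin 4]→ₗ[ℝ] ℝ) (hvol : 0 < vol e * vol e') (ζ : Fin 3 → ℝ) :
    frameTransition g x e e' ζ ⬝ᵥ frameTransition g x e e' ζ = ζ ⬝ᵥ ζ := by
  have h1 : ∑ c, ∑ d, frameMatrix g e (frameComplexStructure g x e' ζ) c d ^ 2 = 4 * (ζ ⬝ᵥ ζ) := by
    rw [frameMatrix_frameComplexStructure_frame' he' hE,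
      Matrix.sum_sq_conj_of_orthogonal _ _ (frameCoeff_mul_transpose he he' hE),
      sum_sq_twistorMatrix]
  rw [frameComplexStructure_frameChange he he' hE vol hvol, frameMatrix_frameComplexStructure he,
    sum_sq_twistorMatrix] at h1
  linarith

omit [FiniteDimensional ℝ E] in
/-- `frameTransition g x e e` is the identity. [folklore] -/
theorem frameTransition_self (he : g.IsOrthonormalFrame x e) (ζ : Fin 3 → ℝ) :
    frameTransition g x e e ζ = ζ := by
  ext m
  rw [frameTransition_apply, ← frameMatrix_apply, frameMatrix_frameComplexStructure he,
    twistorMatrix_zero_succ]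

/-- **Cocycle identity**: `T(e, e') (T(e', e'') ζ) = T(e, e'') ζ` for pairwise like-oriented
orthonormal frames. [cite: AtiyahHitchinSinger1978, §1] -/
theorem frameTransition_frameTransition {e'' : Fin 4 → TangentSpace I x}
    (he : g.IsOrthonormalFrame x e) (he' : g.IsOrthonormalFrame x e')
    (he'' : g.IsOrthonormalFrame x e'') (hE : finrank ℝ E = 4)
    (vol : TangentSpace I x [⋀^Fin 4]→ₗ[ℝ] ℝ) (hvol : 0 < vol e * vol e')
    (hvol' : 0 < vol e' * vol e'') (ζ : Fin 3 → ℝ) :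
    frameTransition g x e e' (frameTransition g x e' e'' ζ) = frameTransition g x e e'' ζ := by
  ext m
  rw [frameTransition_apply, frameTransition_apply,
    frameComplexStructure_frameChange he' he'' hE vol hvol' ζ,
    frameComplexStructure_frameChange he he' hE vol hvol, ← frameMatrix_apply,
    frameMatrix_frameComplexStructure he, twistorMatrix_zero_succ]

/-- **`frameTransition` preserves the dot and the cross product** (it lies in `SO(3)`): the
quaternion relations hold in both frames. [cite: AtiyahHitchinSinger1978, §1] -/
theorem frameTransition_dotProduct_crossProduct (he : g.IsOrthonormalFrame x e)
    (he' : g.IsOrthonormalFrame x e') (hE : finrank ℝ E = 4)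
    (vol : TangentSpace I x [⋀^Fin 4]→ₗ[ℝ] ℝ) (hvol : 0 < vol e * vol e') (ζ η : Fin 3 → ℝ) :
    frameTransition g x e e' ζ ⬝ᵥ frameTransition g x e e' η = ζ ⬝ᵥ η ∧
      frameTransition g x e e' (crossProduct ζ η) =
        crossProduct (frameTransition g x e e' ζ) (frameTransition g x e e' η) := by
  set T := frameTransition g x e e' with hT
  have h := frameComplexStructure_comp he' hE ζ η
  rw [frameComplexStructure_frameChange he he' hE vol hvol ζ,
    frameComplexStructure_frameChange he he' hE vol hvol η,
    frameComplexStructure_frameChange he he' hE vol hvol (crossProduct ζ η),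
    frameComplexStructure_comp he hE, ← hT] at h
  have hm := congrArg (frameMatrix g e) h
  rw [frameMatrix_add, frameMatrix_add, frameMatrix_smul, frameMatrix_smul, frameMatrix_id he,
    frameMatrix_frameComplexStructure he, frameMatrix_frameComplexStructure he] at hm
  have h00 := congrFun (congrFun hm 0) 0
  simp [twistorMatrix] at h00
  refine ⟨h00, ?_⟩
  ext m
  have hm' := congrFun (congrFun hm 0) m.succ
  simp only [Matrix.add_apply, Matrix.smul_apply, twistorMatrix_zero_succ, smul_eq_mul,
    Matrix.one_apply] at hm'
  have : (0 : Fin 4) ≠ m.succ := (Fin.succ_ne_zero m).symm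
  simp only [this, if_false, mul_zero, zero_add] at hm'
  exact hm'.symm

end Frame

end Literature.Geometry.Riemannian
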